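import Literature.Probability.LatticeModels.IsingThermodynamics
import HarnessLib

/-!
# Exponential decay of the truncated two-point function of the supercritical Ising model on `ℤ^d`,
# `d ≥ 3` (Duminil-Copin–Goswami–Raoufi 2020, Thm 1.1) — ONE named fact

H. Duminil-Copin, S. Goswami, A. Raoufi, *Exponential decay of truncated correlations for the Ising
model in any dimension for all but the critical temperature*, Comm. Math. Phys. **374** (2020)
891–921 = arXiv:1808.00439 [DuminilCopinGoswamiRaoufi2020], **Theorem 1.1** (p. 2 of the arXiv
version): «For the nearest-neighbor Ising model on `ℤ^d` in dimension `d ≥ 3`, for any `β > β_c` there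
exists `c = c(β,d) > 0` such that for every `x, y ∈ ℤ^d`,
`0 ≤ ⟨σ_x ; σ_y⟩⁺_β ≤ exp[-c‖x - y‖]`», where `⟨σ_x;σ_y⟩ := ⟨σ_xσ_y⟩ - ⟨σ_x⟩⟨σ_y⟩` is the truncated
two-point function and `⟨·⟩⁺_β` the plus state (the paper recalls `β < β_c ⇒ ⟨σ_x⟩⁺_β = 0`,
`β > β_c ⇒ ⟨σ_x⟩⁺_β > 0`, i.e. `β_c` is the magnetisation threshold — the tree's `criticalBeta d`).
The proof (§§2–4 of the source: random currents, the FK–Ising exponential mixing Thm 1.3, Pisztora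
coarse graining and Bodineau's slab-threshold identification) is NOT in the tree; the `d = 2` case
(Onsager ∕ duality) and `β < β_c` (Aizenman–Barsky–Fernández sharpness,
`twoPoint_exponentialDecay_of_lt_criticalBeta`) are separate results.

Vocabulary: the tree's plus-state correlations `plusCorr d β 0 A = ⟨σ_A⟩⁺_{β,0}` (box limits of
the plus-boundary finite-volume states, `hasBoxLimit_isingCorr_plus`), with `σ_xσ_y = σ_{{x}∆{y}}`
(so the statement at `x = y` reads `0 ≤ 1 - (m*)² ≤ 1`, as printed), and the sup norm `‖·‖` of
`Site d = ℤ^d` (the printed norm is not specified beyond `‖x - y‖`; for the Euclidean or `ℓ¹` norm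
the printed bound implies the sup-norm one with the same `c`, since `‖·‖_∞ ≤ ‖·‖₂ ≤ ‖·‖₁`).

Requested by the `ym-ir` census calibration row A5 ∕ DS26: it is the dual-supercritical input
«[DCGR20]» of Duncan–Schweinhart's plaquette–plaquette mass gap for `ℤ₂` lattice gauge theory on
`ℤ³` in the confined phase (`IsingGaugePlaquetteCovarianceDuality.lean` proves the deconfined phase
and reduces the confined phase to this fact). HONEST FRAMING: a `d ≥ 3` Ising-model theorem; nothing
here bears on Yang–Mills or the mass gap (Clay).

## References

* H. Duminil-Copin, S. Goswami, A. Raoufi, Comm. Math. Phys. 374 (2020) 891–921, arXiv:1808.00439,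
  Thm 1.1 (and Lemma 1.2, Thm 1.3). [DuminilCopinGoswamiRaoufi2020]
-/

noncomputable section

open scoped symmDiff

namespace Literature.Probability.LatticeModels

/-- **Duminil-Copin–Goswami–Raoufi 2020, Theorem 1.1** (exponential decay of the truncated
two-point function of the plus state throughout the ordered phase): for the nearest-neighbour Ising
model on `ℤ^d`, `d ≥ 3`, and every `β > β_c(d)` there is `c = c(β,d) > 0` such that for all
`x, y ∈ ℤ^d`, `0 ≤ ⟨σ_xσ_y⟩⁺_β - ⟨σ_x⟩⁺_β⟨σ_y⟩⁺_β ≤ exp(-c‖x - y‖)` (plus state at zero field,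
`plusCorr d β 0`; `σ_xσ_y = σ_{{x}∆{y}}`; sup norm on `ℤ^d`). NAMED FACT — the proof (random
currents + FK–Ising exponential mixing + Pisztora coarse graining + Bodineau's slab threshold) is not
in the tree. [cite: DuminilCopinGoswamiRaoufi2020, Thm 1.1] -/
def DuminilCopinGoswamiRaoufi2020_truncatedTwoPointPlus_expDecay (d : ℕ) : Prop :=
  3 ≤ d → ∀ β : ℝ, criticalBeta d < β → ∃ c : ℝ, 0 < c ∧ ∀ x y : Site d,
    0 ≤ plusCorr d β 0 ({x} ∆ {y}) - plusCorr d β 0 {x} * plusCorr d β 0 {y} ∧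
      plusCorr d β 0 ({x} ∆ {y}) - plusCorr d β 0 {x} * plusCorr d β 0 {y} ≤
        Real.exp (-(c * ‖x - y‖))

end Literature.Probability.LatticeModels
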